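import Mathlib

/-!
# Norm-coherent roots in a tower of groups (Kőnig), and the one-level Gras certificate

Route `ResidualThetaTransportAtTwo`, seed crux `SignedMuSeedAtTwoPlus` (stmt-BirchSwinnertonDyer-21438),
idea / line card `gras-leopoldt-split` (crux-ideate k1 g16): the fine half (F) of the seed is split as
GRAS-μ × LEOPOLDT-μ inside a free rank-two local module, and the GRAS factor
(`f̄₀ ≠ 0` ⟺ the norm-coherent ρ-elliptic unit `ζ` is NOT the square of a norm-coherent family of
global units, additively `ζ ∉ 2·Ē_∞`) is certified at ONE finite level.

This file supplies, as pure algebra (no arithmetic object is constructed here), the kernel lemmas the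
card calls FL1 / FL3 and the algebra behind its stub S2 (`stub_grasCertificate`):

* `exists_normCoherent_pow_eq` — **Kőnig for roots in a tower.** In a tower of commutative groups
  `E m` with norm maps `N m : E (m+1) →* E m`, if the `n`-torsion of every `E m` is finite and a
  norm-coherent family `ζ` is an `n`-th power at every level, then `ζ` is the `n`-th power of a
  NORM-COHERENT family (Mathlib's `nonempty_sections_of_finite_inverse_system` on the finite non-empty
  fibres `{θ : θ ^ n = ζ_m}`).
* `pow_of_succ` / `isSquare_of_succ` (FL3) — if `ζ_{m+1}` is an `n`-th power up to a torsion factor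
  killed by the norm (e.g. `± η²`, `N(−1) = 1` in even degree), then `ζ_m = N ζ_{m+1}` is an honest
  `n`-th power.
* `normCoherent_sqrt` (FL1, the card's signature VERBATIM) and the general form
  `exists_normCoherent_pow_eq_of_torsion_killed`.
* `normCoherent_torsion_eq_one`, `normCoherent_sqrt_unique`, `existsUnique_normCoherent_sqrt` —
  «`±1` is not norm-coherent» (k2 g10 T3): the norm-coherent square root is UNIQUE.
* `exists_normCoherent_sqrt_iff` — square of a norm-coherent family ⟺ `±` a square at EVERY level;
  `not_exists_normCoherent_sqrt_of_level` — the finite certificate GNS(m₀): `ζ_{m₀} ∉ ± E_{m₀}²` at ONE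
  level ⟹ `ζ` is not the square of a norm-coherent family.
* (appended) `reducedCoordinate_ne_zero_iff` (FL2, restated from the sketch), `reduction_ne_zero_of_isRelPrime`
  (content one ⟹ non-zero mod a non-unit), `reduction_coordinate_ne_zero_iff` — the SPLITTING in
  coordinates: for `ζ = f₀ • g • e`, `e` of content one, `R/c` a domain: `ζ̄ ≠ 0 ⟺ c ∤ g ∧ c ∤ f₀`.
* `exists_mem_span_singleton_smul_eq_iff_dvd` — the S2 algebra: for a torsion-free vector `x`
  (the card's `g • e`, `Ē^χ_∞ = Λ′·ge` free of rank one) and `ζ = f₀ • x`,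
  `ζ ∈ c • (R ∙ x) ⟺ c ∣ f₀`; with `c = 2` and `Ideal.Quotient.eq_zero_iff_dvd` this is
  «`ζ^χ ∈ 2Ē^χ_∞ ⟺ f̄₀ = 0`».

Nothing here proves BSD, the crux, the seed or (F); these are helper lemmas `--supports` the seed item.
Sources: line card `Cruxes/SignedMuSeedAtTwoPlus/Lines/gras-leopoldt-split.md`, sketch
`Cruxes/SignedMuSeedAtTwoPlus/GrasLeopoldtSplitSketch.lean` (FL1 was its only `sorry`); Kőnig's lemma
[folklore]; Lang, *Cyclotomic Fields I–II*, Ch. 6 (structure of units in the cyclotomic tower) for context.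
-/

set_option autoImplicit false
set_option linter.dupNamespace false

namespace Summit.BirchSwinnertonDyer.BirchSwinnertonDyer.Theorems.SignedMuAtTwo.GrasLeopoldt

open CategoryTheory

universe u

variable {E : ℕ → Type u} [∀ m, CommGroup (E m)] (N : ∀ m, E (m + 1) →* E m)

/-- **Kőnig for roots in a tower of groups.** `E m` commutative groups with norm maps
`N m : E (m+1) →* E m`; the `n`-torsion `{x : E m | x ^ n = 1}` of every level is finite; `ζ` is a
norm-coherent family which is an `n`-th power at every level. Then `ζ = θ ^ n` for a NORM-COHERENT
family `θ`. Proof: the fibres `{θ : E m // θ ^ n = ζ m}` are non-empty, finite (a translate of the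
`n`-torsion) and mapped into each other by the norms; a thread exists by
`nonempty_sections_of_finite_inverse_system`. [folklore] -/
theorem exists_normCoherent_pow_eq (n : ℕ)
    (hfin : ∀ m, Set.Finite {x : E m | x ^ n = 1})
    (ζ : ∀ m, E m) (hζ : ∀ m, N m (ζ (m + 1)) = ζ m)
    (hpow : ∀ m, ∃ η : E m, ζ m = η ^ n) :
    ∃ θ : ∀ m, E m, (∀ m, N m (θ (m + 1)) = θ m) ∧ ∀ m, ζ m = θ m ^ n := by
  -- the fibres and the transition maps
  let X : ℕ → Type u := fun m => {x : E m // x ^ n = ζ m}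
  let f : ∀ m, X (m + 1) ⟶ X m := fun m =>
    TypeCat.ofHom fun x => ⟨N m x.1, by rw [← map_pow, x.2, hζ]⟩
  let F : ℕᵒᵖ ⥤ Type u := Functor.ofOpSequence f
  have hXfin : ∀ m, Finite (X m) := fun m => by
    obtain ⟨η, hη⟩ := hpow m
    haveI : Finite {x : E m | x ^ n = 1} := (hfin m).to_subtype
    refine Finite.of_injective
      (fun x : X m => (⟨x.1 * η⁻¹, ?_⟩ : {x : E m | x ^ n = 1})) ?_
    · show (x.1 * η⁻¹) ^ n = 1
      rw [mul_pow, inv_pow, x.2, hη, mul_inv_cancel]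
    · intro x y hxy
      have h := congrArg Subtype.val hxy
      exact Subtype.ext (mul_right_cancel h)
  have hXne : ∀ m, Nonempty (X m) := fun m => by
    obtain ⟨η, hη⟩ := hpow m
    exact ⟨⟨η, hη.symm⟩⟩
  haveI : ∀ j : ℕᵒᵖ, Finite (F.obj j) := fun j => hXfin j.unop
  haveI : ∀ j : ℕᵒᵖ, Nonempty (F.obj j) := fun j => hXne j.unop
  obtain ⟨s, hs⟩ := nonempty_sections_of_finite_inverse_system F
  refine ⟨fun m => (show X m from s (Opposite.op m)).1, fun m => ?_, fun m => ?_⟩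
  · have h := hs (homOfLE (Nat.le_add_right m 1)).op
    rw [Functor.ofOpSequence_map_homOfLE_succ] at h
    exact congrArg Subtype.val h
  · exact ((show X m from s (Opposite.op m)).2).symm

/-- **FL3, general exponent.** If `ζ_{m+1} = w · η ^ n` with `w` killed by the norm (`N w = 1`),
then `ζ_m = N ζ_{m+1} = (N η) ^ n` is an honest `n`-th power at level `m`. [folklore] -/
theorem pow_of_succ (n : ℕ) (ζ : ∀ m, E m) (hζ : ∀ m, N m (ζ (m + 1)) = ζ m) (m : ℕ)
    (h : ∃ (η w : E (m + 1)), N m w = 1 ∧ ζ (m + 1) = w * η ^ n) :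
    ∃ θ : E m, ζ m = θ ^ n := by
  obtain ⟨η, w, hw, hη⟩ := h
  exact ⟨N m η, by rw [← hζ m, hη, map_mul, hw, one_mul, map_pow]⟩

/-- **FL3 (the card's form, squares and one sign `t_m`).** With `N (t_{m+1}) = 1` (e.g. `t = −1`,
`N(−1) = 1` in even relative degree): if `ζ_{m+1}` is `±` a square then `ζ_m = N ζ_{m+1}` is a square.
[folklore] -/
theorem isSquare_of_succ (t : ∀ m, E m) (htN : ∀ m, N m (t (m + 1)) = 1)
    (ζ : ∀ m, E m) (hζ : ∀ m, N m (ζ (m + 1)) = ζ m) (m : ℕ)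
    (hsq : ∃ η : E (m + 1), ζ (m + 1) = η ^ 2 ∨ ζ (m + 1) = t (m + 1) * η ^ 2) :
    ∃ θ : E m, ζ m = θ ^ 2 := by
  obtain ⟨η, h | h⟩ := hsq
  · exact ⟨N m η, by rw [← hζ m, h, map_pow]⟩
  · exact ⟨N m η, by rw [← hζ m, h, map_mul, htN m, one_mul, map_pow]⟩

/-- **Kőnig for roots, torsion-killed form.** If the `n`-torsion of every level is finite and KILLED
by the norm one level down (`w ^ n = 1 ⟹ N w = 1`; for `n = 2` in a tower of fields without `√−1` this
is `N(±1) = 1`), and `ζ` is an `n`-th power UP TO `n`-TORSION at every level, then `ζ` is the `n`-th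
power of a norm-coherent family. [folklore] -/
theorem exists_normCoherent_pow_eq_of_torsion_killed (n : ℕ)
    (hfin : ∀ m, Set.Finite {x : E m | x ^ n = 1})
    (hkill : ∀ m (w : E (m + 1)), w ^ n = 1 → N m w = 1)
    (ζ : ∀ m, E m) (hζ : ∀ m, N m (ζ (m + 1)) = ζ m)
    (hpow : ∀ m, ∃ (η w : E m), w ^ n = 1 ∧ ζ m = w * η ^ n) :
    ∃ θ : ∀ m, E m, (∀ m, N m (θ (m + 1)) = θ m) ∧ ∀ m, ζ m = θ m ^ n := by
  refine exists_normCoherent_pow_eq N n hfin ζ hζ fun m => ?_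
  obtain ⟨η, w, hw, h⟩ := hpow (m + 1)
  exact pow_of_succ N n ζ hζ m ⟨η, w, hkill m w hw, h⟩

/-- **FL1 (line card `gras-leopoldt-split`, VERBATIM signature of the sketch's only `sorry`).**
`E m` = (ρ-relevant) unit group of the `m`-th layer, `N m` the norm, `t m = −1` the only non-trivial
square root of unity (`√−1 ∉ M_m`), `N(−1) = 1`. If the norm-coherent `ζ` is `±` a square at EVERY
level then it is the square of a NORM-COHERENT family, i.e. `ζ ∈ 2·Ē_∞` additively and the Gras
factor vanishes. Proof: FL3 makes every level an honest square, the `2`-torsion `⊆ {1, t_m}` is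
finite, and `exists_normCoherent_pow_eq` (Kőnig) threads the two-element fibres. [folklore] -/
theorem normCoherent_sqrt
    (E : ℕ → Type*) [∀ m, CommGroup (E m)] (N : ∀ m, E (m + 1) →* E m)
    (t : ∀ m, E m) (htN : ∀ m, N m (t (m + 1)) = 1)
    (hroots : ∀ m (x : E m), x ^ 2 = 1 → x = 1 ∨ x = t m)
    (ζ : ∀ m, E m) (hζ : ∀ m, N m (ζ (m + 1)) = ζ m)
    (hsq : ∀ m, ∃ η : E m, ζ m = η ^ 2 ∨ ζ m = t m * η ^ 2) :
    ∃ θ : ∀ m, E m, (∀ m, N m (θ (m + 1)) = θ m) ∧ ∀ m, ζ m = θ m ^ 2 := by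
  refine exists_normCoherent_pow_eq N 2 (fun m => ?_) ζ hζ fun m => ?_
  · exact (Set.toFinite ({1, t m} : Set (E m))).subset fun x hx => by
      rcases hroots m x hx with h | h
      · exact Or.inl h
      · exact Or.inr h
  · exact isSquare_of_succ N t htN ζ hζ m (hsq (m + 1))

/-- **`±1` is not norm-coherent (k2 g10 T3).** If the square roots of unity of every level are
`⊆ {1, t_m}` and `N t_{m+1} = 1`, then a norm-coherent family of square roots of unity is trivial:
`ε_m = N ε_{m+1} ∈ {N 1, N t_{m+1}} = {1}`. [folklore] -/
theorem normCoherent_torsion_eq_one (t : ∀ m, E m) (htN : ∀ m, N m (t (m + 1)) = 1)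
    (hroots : ∀ m (x : E m), x ^ 2 = 1 → x = 1 ∨ x = t m)
    (ε : ∀ m, E m) (hε : ∀ m, N m (ε (m + 1)) = ε m) (h2 : ∀ m, ε m ^ 2 = 1) (m : ℕ) :
    ε m = 1 := by
  rw [← hε m]
  rcases hroots (m + 1) (ε (m + 1)) (h2 (m + 1)) with h | h
  · rw [h, map_one]
  · rw [h, htN]

/-- **Uniqueness of the norm-coherent square root.** Two norm-coherent families with the same squares
are equal (their quotient is a norm-coherent family of square roots of unity). [folklore] -/
theorem normCoherent_sqrt_unique (t : ∀ m, E m) (htN : ∀ m, N m (t (m + 1)) = 1)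
    (hroots : ∀ m (x : E m), x ^ 2 = 1 → x = 1 ∨ x = t m)
    (θ θ' : ∀ m, E m) (hθ : ∀ m, N m (θ (m + 1)) = θ m) (hθ' : ∀ m, N m (θ' (m + 1)) = θ' m)
    (h : ∀ m, θ m ^ 2 = θ' m ^ 2) : θ = θ' := by
  funext m
  have key := normCoherent_torsion_eq_one N t htN hroots (fun m => θ m / θ' m)
    (fun m => by rw [map_div, hθ, hθ']) (fun m => by rw [div_pow, h, div_self']) m
  exact div_eq_one.mp key

/-- **FL1 with uniqueness.** Under the hypotheses of `normCoherent_sqrt` the norm-coherent square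
root of `ζ` exists AND is unique. [folklore] -/
theorem existsUnique_normCoherent_sqrt (t : ∀ m, E m) (htN : ∀ m, N m (t (m + 1)) = 1)
    (hroots : ∀ m (x : E m), x ^ 2 = 1 → x = 1 ∨ x = t m)
    (ζ : ∀ m, E m) (hζ : ∀ m, N m (ζ (m + 1)) = ζ m)
    (hsq : ∀ m, ∃ η : E m, ζ m = η ^ 2 ∨ ζ m = t m * η ^ 2) :
    ∃! θ : ∀ m, E m, (∀ m, N m (θ (m + 1)) = θ m) ∧ ∀ m, ζ m = θ m ^ 2 := by
  obtain ⟨θ, hθ, hζθ⟩ := normCoherent_sqrt E N t htN hroots ζ hζ hsq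
  refine ⟨θ, ⟨hθ, hζθ⟩, fun θ' hθ' => ?_⟩
  exact normCoherent_sqrt_unique N t htN hroots θ' θ hθ'.1 hθ fun m => by
    rw [← hθ'.2 m, ← hζθ m]

/-- **Square of a norm-coherent family ⟺ `±` a square at every level** (the two directions of the
Gras dichotomy: FL1 and the trivial converse). [folklore] -/
theorem exists_normCoherent_sqrt_iff (t : ∀ m, E m) (htN : ∀ m, N m (t (m + 1)) = 1)
    (hroots : ∀ m (x : E m), x ^ 2 = 1 → x = 1 ∨ x = t m)
    (ζ : ∀ m, E m) (hζ : ∀ m, N m (ζ (m + 1)) = ζ m) :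
    (∃ θ : ∀ m, E m, (∀ m, N m (θ (m + 1)) = θ m) ∧ ∀ m, ζ m = θ m ^ 2) ↔
      ∀ m, ∃ η : E m, ζ m = η ^ 2 ∨ ζ m = t m * η ^ 2 := by
  constructor
  · rintro ⟨θ, -, hζθ⟩ m
    exact ⟨θ m, Or.inl (hζθ m)⟩
  · exact normCoherent_sqrt E N t htN hroots ζ hζ

/-- **The one-level Gras certificate GNS(m₀)** (contrapositive bookkeeping, no hypothesis on the
tower needed): if at ONE level `m₀` the element `ζ_{m₀}` is neither a square nor `t_{m₀}` times a
square, then `ζ` is not the square of any family `θ` — in particular not of a norm-coherent one, so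
additively `ζ ∉ 2·Ē_∞` and the Gras factor `f̄₀` is non-zero (`exists_mem_span_singleton_smul_eq_iff_dvd`).
[folklore] -/
theorem not_exists_normCoherent_sqrt_of_level (t : ∀ m, E m) (ζ : ∀ m, E m) (m₀ : ℕ)
    (hm₀ : ∀ η : E m₀, ζ m₀ ≠ η ^ 2 ∧ ζ m₀ ≠ t m₀ * η ^ 2) :
    ¬ ∃ θ : ∀ m, E m, (∀ m, N m (θ (m + 1)) = θ m) ∧ ∀ m, ζ m = θ m ^ 2 := by
  rintro ⟨θ, -, hζθ⟩
  exact (hm₀ (θ m₀)).1 (hζθ m₀)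

/-- **S2 algebra (`stub_grasCertificate`): divisibility of the coordinate along a free line.**
`R` a commutative ring, `x` a torsion-free vector of an `R`-module (`r • x = 0 ⟹ r = 0`; in the card
`x = g • e` generates the free rank-one module `Ē^χ_∞ = Λ′·ge`), `ζ = f • x`. Then
`ζ ∈ c • (R ∙ x)` (i.e. `ζ = c • y` for some `y ∈ R ∙ x`) iff `c ∣ f`. With `c = 2`, `R = Λ′` and
`Ideal.Quotient.eq_zero_iff_dvd` this reads «`ζ^χ ∈ 2Ē^χ_∞ ⟺ f̄₀ = 0 in Λ′/2 = 𝔽₄⟦T⟧`». [folklore] -/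
theorem exists_mem_span_singleton_smul_eq_iff_dvd {R M : Type*} [CommRing R] [AddCommGroup M]
    [Module R M] {x : M} (hx : ∀ r : R, r • x = 0 → r = 0) (f c : R) :
    (∃ y ∈ Submodule.span R {x}, f • x = c • y) ↔ c ∣ f := by
  constructor
  · rintro ⟨y, hy, hfy⟩
    obtain ⟨a, rfl⟩ := Submodule.mem_span_singleton.mp hy
    refine ⟨a, sub_eq_zero.mp (hx _ ?_)⟩
    rw [sub_smul, mul_smul, hfy, sub_self]
  · rintro ⟨a, rfl⟩
    exact ⟨a • x, Submodule.mem_span_singleton.mpr ⟨a, rfl⟩, mul_smul c a x⟩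

/-! ### The splitting `ā ≠ 0 ⟺ ḡ ≠ 0 ∧ f̄₀ ≠ 0` in coordinates (appended, same seat) -/

/-- **FL2 (the card's factorisation core, restated in `Theorems` since `Cruxes/` sketches are not
importable).** Over a DOMAIN `k` (for the line `k = Λ′/2Λ′ = 𝔽₄⟦T⟧`), for a non-zero vector `e`:
`(g·f₀) • e ≠ 0 ⟺ g ≠ 0 ∧ f₀ ≠ 0` — «μ-content of (F) = μ_GRAS + μ_LEOPOLDT». [folklore] -/
theorem reducedCoordinate_ne_zero_iff {k : Type*} [CommRing k] [IsDomain k]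
    (g f₀ : k) (e : Fin 2 → k) (he : e ≠ 0) :
    (g * f₀) • e ≠ 0 ↔ g ≠ 0 ∧ f₀ ≠ 0 := by
  rw [Ne, smul_eq_zero, mul_eq_zero]
  tauto

/-- **A primitive vector stays non-zero modulo any non-unit.** If `e 0, e 1` are relatively prime
(content one) and `c` is not a unit, the reduction `ē` of `e` modulo `c` is non-zero (else `c`
divides both coordinates). For the line: `e` of content one in `Λ′²` ⟹ `ē ≠ 0` in `(𝔽₄⟦T⟧)²`, the
hypothesis of `reducedCoordinate_ne_zero_iff`. [folklore] -/
theorem reduction_ne_zero_of_isRelPrime {R : Type*} [CommRing R] (c : R) (hc : ¬ IsUnit c)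
    (e : Fin 2 → R) (he : IsRelPrime (e 0) (e 1)) :
    (fun i => Ideal.Quotient.mk (Ideal.span {c}) (e i)) ≠ 0 := by
  intro h
  have h0 : c ∣ e 0 := Ideal.mem_span_singleton.mp (Ideal.Quotient.eq_zero_iff_mem.mp (congrFun h 0))
  have h1 : c ∣ e 1 := Ideal.mem_span_singleton.mp (Ideal.Quotient.eq_zero_iff_mem.mp (congrFun h 1))
  exact hc (he h0 h1)

/-- **The splitting in coordinates.** `R` a ring with `c ∈ R` a non-unit generating a PRIME ideal
(`R/c` a domain: `Λ′/2 = 𝔽₄⟦T⟧`), `e ∈ R²` of content one, `ζ = f₀ • g • e` (the elliptic-unit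
coordinate `ζ^χ = f₀·g·e` of the card). Then the reduction `ζ̄ ∈ (R/c)²` is non-zero iff
`c ∤ g` AND `c ∤ f₀`: «(F) ⟺ ā ≠ 0 ⟺ LEOPOLDT-μ = 0 ∧ GRAS-μ = 0». Combine with
`exists_mem_span_singleton_smul_eq_iff_dvd` (`c ∣ f₀ ⟺ ζ ∈ c·(R ∙ ge)`) and
`exists_normCoherent_sqrt_iff` for the Gras factor. [folklore] -/
theorem reduction_coordinate_ne_zero_iff {R : Type*} [CommRing R] (c : R) (hc : ¬ IsUnit c)
    [hp : (Ideal.span {c}).IsPrime] (e : Fin 2 → R) (he : IsRelPrime (e 0) (e 1)) (g f₀ : R) :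
    (fun i => Ideal.Quotient.mk (Ideal.span {c}) ((f₀ • g • e) i)) ≠ 0 ↔ ¬ c ∣ g ∧ ¬ c ∣ f₀ := by
  haveI : IsDomain (R ⧸ Ideal.span {c}) := Ideal.Quotient.isDomain _
  have hē := reduction_ne_zero_of_isRelPrime c hc e he
  have key : (fun i => Ideal.Quotient.mk (Ideal.span {c}) ((f₀ • g • e) i)) =
      (Ideal.Quotient.mk (Ideal.span {c}) g * Ideal.Quotient.mk (Ideal.span {c}) f₀) •
        fun i => Ideal.Quotient.mk (Ideal.span {c}) (e i) := by
    funext i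
    simp only [Pi.smul_apply, smul_eq_mul, map_mul]
    ring
  rw [key, reducedCoordinate_ne_zero_iff _ _ _ hē, Ne, Ne, Ideal.Quotient.eq_zero_iff_dvd,
    Ideal.Quotient.eq_zero_iff_dvd]

end Summit.BirchSwinnertonDyer.BirchSwinnertonDyer.Theorems.SignedMuAtTwo.GrasLeopoldt
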